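import Summits.Ventures.LatticeQCDFlow.Exactness.IMHCommonRandomNumbersMergedForever
import Summits.Ventures.LatticeQCDFlow.Exactness.IMHCommonRandomNumbersPath
import HarnessLib

/-!
# The coupling inequality for flow-MCMC with the common-random-numbers coupling as witness: every bounded statistic of the
# whole future after `b` updates differs between the two runs by at most `(1 − A)^b·P(X_0 ≠ X′_0)` times its range, in mean,
# and between ANY two initial laws by at most `(1 − A)^b·μ̂₀(Δᶜ)` times its range for EVERY coupling `μ̂₀` of them

HONEST FRAMING: exact (Metropolis-corrected) sampling algorithms for lattice gauge theory;
figures of merit are autocorrelation/cost numbers at stated couplings and volumes; no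
continuum-physics claim.

Venture `LatticeQCDFlow` (cell pub-lqcd), topic `Exactness`; FANOUT row 30 (lean-1, GEN-38).  NEW WORK of the cell,
general state space with `MeasurableEq Ω`; sequel to this generation's `Exactness/IMHCommonRandomNumbersMergedForever`
(on the pair path law of the CRN pair kernel `K̂` of `K = indepMH q w`, `P̂(∃ m ≥ b, X_m ≠ X′_m) ≤ r^b·P(X_0 ≠ X′_0)`,
`r = 1 − A`, `A = 1/w(x₀)`, `w` normalised and maximal at `x₀`; «NOT CLAIMED: observables of the whole future») and to
GEN-36's `Exactness/IMHCommonRandomNumbersPath` (each coordinate of the coupled simulation IS a run: `P̂_{μ̂₀}∘(π₁)⁻¹ =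
P_{μ̂₀∘fst⁻¹}`; `E|F(X_{b+·}) − F(X′_{b+·})| ≤ r^b·(c − a)` WITHOUT the initial-disagreement factor).  Here the factor is
recovered for path statistics, and the result is read as a COUPLING INEQUALITY between two arbitrary starts:

* §1 **`crn_chain_path_integral_abs_sub_le_init`** — for every measurable path statistic `a ≤ F ≤ c`, every `b` and every
  initial coupling: `E|F(X_{b+·}) − F(X′_{b+·})| ≤ r^b·P(X_0 ≠ X′_0)·(c − a)` (pointwise the difference vanishes unless the
  runs still differ at some `m ≥ b`); **`crn_chain_path_integral_sq_sub_le_init`** — `E(F(X_{b+·}) − F(X′_{b+·}))² ≤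
  r^b·P(X_0 ≠ X′_0)·(c − a)²`; **`crn_chain_path_integral_sub_abs_le_init`** — `|E F(X_{b+·}) − E F(X′_{b+·})| ≤
  r^b·P(X_0 ≠ X′_0)·(c − a)`.
* §2 **`imh_chain_shift_integral_sub_le_of_coupling`** — THE COUPLING INEQUALITY FOR THE EXACT SAMPLER (no pair kernel in
  the statement; the CRN kernel exists by GEN-36 `exists_crnPairKernel` and is the witness): for EVERY probability law `μ̂₀`
  on `Ω × Ω` and the two runs of `K` from its marginals `μ̂₀∘fst⁻¹`, `μ̂₀∘snd⁻¹`: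
  `|E_{μ̂₀∘fst⁻¹} F(X_{b+·}) − E_{μ̂₀∘snd⁻¹} F(X_{b+·})| ≤ r^b·μ̂₀(Δᶜ)·(c − a)` — ANY COUPLING CERTIFICATE OF TWO STARTS
  (two configurations that differ on a few links with known probability, a checkpoint and its perturbation, a model draw
  and its refresh) bounds the difference of every future path statistic, improved by `(1 − A)^b` after `b` discards
  (GEN-37 `IMHPathTotalVariationContraction`: the same with the SET-WISE distance `δ` of the two initial laws; here any
  coupling's disagreement mass, which is what one has in hand when the two starts are built from each other).
Reading (gauge files): perturb a configuration of the exact gauge sampler on a set of links of probability `p`; every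
statistic of the two futures after `b` updates differs in expectation by at most `(1 − A)^b·p` times its range.
NOT CLAIMED: the infimum over couplings (the total-variation form is GEN-37's file); statistics of unbounded range; anything
for two different proposals or any value of `A`.  No `sorry`, no new definitions, nothing cited as a fact.
-/

noncomputable section

namespace Summit.Ventures.LatticeQCDFlow.Exactness

open MeasureTheory ProbabilityTheory Function Finset Filter
open scoped ENNReal unitInterval
open Summit.Ventures.LatticeQCDFlow.Scoring

variable {Ω : Type*} [MeasurableSpace Ω] {q : Measure Ω} [IsProbabilityMeasure q] {w : Ω → ℝ}

/-! ## §1 Path statistics of the two coupled runs, with the initial-disagreement factor -/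

omit [IsProbabilityMeasure q] in
/-- The event «the runs still differ at some time `m ≥ b`» is measurable (`MeasurableEq Ω`). [ours, bookkeeping] -/
theorem measurableSet_notMerged_after [MeasurableEq Ω] (b : ℕ) :
    MeasurableSet {z : ℕ → Ω × Ω | ∃ m, b ≤ m ∧ z m ∉ Set.diagonal Ω} := by
  have : {z : ℕ → Ω × Ω | ∃ m, b ≤ m ∧ z m ∉ Set.diagonal Ω} = ⋃ m, ⋃ (_ : b ≤ m), {z | z m ∉ Set.diagonal Ω} := by
    ext z; simp
  rw [this]
  exact MeasurableSet.iUnion fun m => MeasurableSet.iUnion fun _ =>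
    measurableSet_diagonal.compl.preimage (measurable_pi_apply m)

omit [MeasurableSpace Ω] [IsProbabilityMeasure q] in
/-- Pointwise: `|F(z₁(b+·)) − F(z₂(b+·))| ≤ (c − a)·1{∃ m ≥ b, z m ∉ Δ}` for `a ≤ F ≤ c`. [ours, bookkeeping] -/
theorem abs_pathStat_sub_le_indicator (b : ℕ) {F : (ℕ → Ω) → ℝ} {a c : ℝ} (ha : ∀ x, a ≤ F x) (hc : ∀ x, F x ≤ c)
    (z : ℕ → Ω × Ω) :
    |F (fun n => (z (b + n)).1) - F (fun n => (z (b + n)).2)| ≤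
      (c - a) * ({z : ℕ → Ω × Ω | ∃ m, b ≤ m ∧ z m ∉ Set.diagonal Ω}).indicator 1 z := by
  by_cases hz : z ∈ {z : ℕ → Ω × Ω | ∃ m, b ≤ m ∧ z m ∉ Set.diagonal Ω}
  · rw [Set.indicator_of_mem hz, Pi.one_apply, mul_one]
    have h1 := ha (fun n => (z (b + n)).1); have h2 := hc (fun n => (z (b + n)).1)
    have h3 := ha (fun n => (z (b + n)).2); have h4 := hc (fun n => (z (b + n)).2)
    exact abs_le.2 ⟨by linarith, by linarith⟩
  · rw [Set.indicator_of_notMem hz, mul_zero]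
    have heq : (fun n => (z (b + n)).1) = fun n => (z (b + n)).2 := by
      funext n
      by_contra hne
      exact hz ⟨b + n, Nat.le_add_right b n, fun hd => hne (Set.mem_diagonal_iff.1 hd)⟩
    rw [heq, sub_self, abs_zero]

/-- **`E|F(X_{b+·}) − F(X′_{b+·})| ≤ r^b·P(X_0 ≠ X′_0)·(c − a)`** for every measurable path statistic `a ≤ F ≤ c`, every `b` and
every initial coupling of the CRN pair chain (`w` normalised, maximal at `x₀`, `r = 1 − 1/w(x₀)`; `MeasurableEq Ω`). [ours] -/
theorem crn_chain_path_integral_abs_sub_le_init [MeasurableEq Ω] (hw : Measurable w) (hw0 : ∀ y, 0 < w y) {x₀ : Ω}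
    (hmax : ∀ y, w y ≤ w x₀) [IsProbabilityMeasure (q.withDensity fun y => ENNReal.ofReal (w y))]
    (Khat : Kernel (Ω × Ω) (Ω × Ω)) [IsMarkovKernel Khat]
    (hK : ∀ z : Ω × Ω, Khat z = (q.prod (volume : Measure unitInterval)).map (fun p : Ω × unitInterval =>
      ((if (p.2 : ℝ) * w z.1 ≤ w p.1 then p.1 else z.1), (if (p.2 : ℝ) * w z.2 ≤ w p.1 then p.1 else z.2))))
    (μ₀ : Measure (Ω × Ω)) [IsProbabilityMeasure μ₀] (b : ℕ) {F : (ℕ → Ω) → ℝ} (hF : Measurable F) {a c : ℝ}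
    (ha : ∀ x, a ≤ F x) (hc : ∀ x, F x ≤ c) :
    ∫ z, |F (fun n => (z (b + n)).1) - F (fun n => (z (b + n)).2)|
        ∂(Kernel.trajMeasure (X := fun _ : ℕ => Ω × Ω) μ₀
          (fun n : ℕ => Khat.comap (fun h : (i : ↥(Finset.Iic n)) → Ω × Ω => h ⟨n, Finset.mem_Iic.2 le_rfl⟩)
            (measurable_pi_apply _))) ≤ (1 - (w x₀)⁻¹) ^ b * μ₀.real (Set.diagonal Ω)ᶜ * (c - a) := by
  set P := Kernel.trajMeasure (X := fun _ : ℕ => Ω × Ω) μ₀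
      (fun n : ℕ => Khat.comap (fun h : (i : ↥(Finset.Iic n)) → Ω × Ω => h ⟨n, Finset.mem_Iic.2 le_rfl⟩)
        (measurable_pi_apply _)) with hP
  have hE := measurableSet_notMerged_after (Ω := Ω) b
  have hca : 0 ≤ c - a := by
    have h1 := ha (fun _ => x₀); have h2 := hc (fun _ => x₀); linarith
  have hGm : Measurable (fun z : ℕ → Ω × Ω => |F (fun n => (z (b + n)).1) - F (fun n => (z (b + n)).2)|) :=
    ((hF.comp (measurable_pi_lambda _ fun n => measurable_fst.comp (measurable_pi_apply (b + n)))).sub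
      (hF.comp (measurable_pi_lambda _ fun n => measurable_snd.comp (measurable_pi_apply (b + n))))).abs
  have hGi : Integrable (fun z : ℕ → Ω × Ω => |F (fun n => (z (b + n)).1) - F (fun n => (z (b + n)).2)|) P :=
    integrable_of_bounded P hGm (C := c - a) (fun z => by
      rw [abs_abs]
      have h1 := ha (fun n => (z (b + n)).1); have h2 := hc (fun n => (z (b + n)).1)
      have h3 := ha (fun n => (z (b + n)).2); have h4 := hc (fun n => (z (b + n)).2)
      exact abs_le.2 ⟨by linarith, by linarith⟩)
  have hIi : Integrable (fun z : ℕ → Ω × Ω =>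
      (c - a) * ({z : ℕ → Ω × Ω | ∃ m, b ≤ m ∧ z m ∉ Set.diagonal Ω}).indicator 1 z) P :=
    ((integrable_const (1 : ℝ)).indicator hE).const_mul _
  have h := crn_chain_notMerged_after_le hw hw0 hmax Khat hK μ₀ b
  rw [← hP] at h
  calc ∫ z, |F (fun n => (z (b + n)).1) - F (fun n => (z (b + n)).2)| ∂P
      ≤ ∫ z, (c - a) * ({z : ℕ → Ω × Ω | ∃ m, b ≤ m ∧ z m ∉ Set.diagonal Ω}).indicator 1 z ∂P :=
        integral_mono hGi hIi fun z => abs_pathStat_sub_le_indicator b ha hc z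
    _ = (c - a) * P.real {z : ℕ → Ω × Ω | ∃ m, b ≤ m ∧ z m ∉ Set.diagonal Ω} := by
        rw [integral_const_mul, integral_indicator_one hE]
    _ ≤ (c - a) * ((1 - (w x₀)⁻¹) ^ b * μ₀.real (Set.diagonal Ω)ᶜ) := mul_le_mul_of_nonneg_left h hca
    _ = _ := by ring

/-- **`E(F(X_{b+·}) − F(X′_{b+·}))² ≤ r^b·P(X_0 ≠ X′_0)·(c − a)²`** in the same setting. [ours] -/
theorem crn_chain_path_integral_sq_sub_le_init [MeasurableEq Ω] (hw : Measurable w) (hw0 : ∀ y, 0 < w y) {x₀ : Ω}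
    (hmax : ∀ y, w y ≤ w x₀) [IsProbabilityMeasure (q.withDensity fun y => ENNReal.ofReal (w y))]
    (Khat : Kernel (Ω × Ω) (Ω × Ω)) [IsMarkovKernel Khat]
    (hK : ∀ z : Ω × Ω, Khat z = (q.prod (volume : Measure unitInterval)).map (fun p : Ω × unitInterval =>
      ((if (p.2 : ℝ) * w z.1 ≤ w p.1 then p.1 else z.1), (if (p.2 : ℝ) * w z.2 ≤ w p.1 then p.1 else z.2))))
    (μ₀ : Measure (Ω × Ω)) [IsProbabilityMeasure μ₀] (b : ℕ) {F : (ℕ → Ω) → ℝ} (hF : Measurable F) {a c : ℝ}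
    (ha : ∀ x, a ≤ F x) (hc : ∀ x, F x ≤ c) :
    ∫ z, (F (fun n => (z (b + n)).1) - F (fun n => (z (b + n)).2)) ^ 2
        ∂(Kernel.trajMeasure (X := fun _ : ℕ => Ω × Ω) μ₀
          (fun n : ℕ => Khat.comap (fun h : (i : ↥(Finset.Iic n)) → Ω × Ω => h ⟨n, Finset.mem_Iic.2 le_rfl⟩)
            (measurable_pi_apply _))) ≤ (1 - (w x₀)⁻¹) ^ b * μ₀.real (Set.diagonal Ω)ᶜ * (c - a) ^ 2 := by
  set P := Kernel.trajMeasure (X := fun _ : ℕ => Ω × Ω) μ₀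
      (fun n : ℕ => Khat.comap (fun h : (i : ↥(Finset.Iic n)) → Ω × Ω => h ⟨n, Finset.mem_Iic.2 le_rfl⟩)
        (measurable_pi_apply _)) with hP
  have hE := measurableSet_notMerged_after (Ω := Ω) b
  have hca : 0 ≤ c - a := by
    have h1 := ha (fun _ => x₀); have h2 := hc (fun _ => x₀); linarith
  have hDm : Measurable (fun z : ℕ → Ω × Ω => F (fun n => (z (b + n)).1) - F (fun n => (z (b + n)).2)) :=
    (hF.comp (measurable_pi_lambda _ fun n => measurable_fst.comp (measurable_pi_apply (b + n)))).sub
      (hF.comp (measurable_pi_lambda _ fun n => measurable_snd.comp (measurable_pi_apply (b + n))))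
  have hDb : ∀ z : ℕ → Ω × Ω, |F (fun n => (z (b + n)).1) - F (fun n => (z (b + n)).2)| ≤ c - a := fun z => by
    have h1 := ha (fun n => (z (b + n)).1); have h2 := hc (fun n => (z (b + n)).1)
    have h3 := ha (fun n => (z (b + n)).2); have h4 := hc (fun n => (z (b + n)).2)
    exact abs_le.2 ⟨by linarith, by linarith⟩
  have hSi : Integrable (fun z : ℕ → Ω × Ω => (F (fun n => (z (b + n)).1) - F (fun n => (z (b + n)).2)) ^ 2) P :=
    integrable_of_bounded P (hDm.pow_const 2) (C := (c - a) ^ 2) (fun z => by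
      rw [abs_pow]; exact pow_le_pow_left₀ (abs_nonneg _) (hDb z) 2)
  have hIi : Integrable (fun z : ℕ → Ω × Ω =>
      (c - a) ^ 2 * ({z : ℕ → Ω × Ω | ∃ m, b ≤ m ∧ z m ∉ Set.diagonal Ω}).indicator 1 z) P :=
    ((integrable_const (1 : ℝ)).indicator hE).const_mul _
  -- pointwise: the square is `|·|·|·| ≤ (c − a)·((c − a)·1_E)`
  have hpt : ∀ z : ℕ → Ω × Ω, (F (fun n => (z (b + n)).1) - F (fun n => (z (b + n)).2)) ^ 2 ≤
      (c - a) ^ 2 * ({z : ℕ → Ω × Ω | ∃ m, b ≤ m ∧ z m ∉ Set.diagonal Ω}).indicator 1 z := by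
    intro z
    have h1 := abs_pathStat_sub_le_indicator b ha hc z
    have hI0 : 0 ≤ ({z : ℕ → Ω × Ω | ∃ m, b ≤ m ∧ z m ∉ Set.diagonal Ω}).indicator (1 : (ℕ → Ω × Ω) → ℝ) z :=
      Set.indicator_nonneg (fun _ _ => zero_le_one) _
    rw [← sq_abs]
    calc |F (fun n => (z (b + n)).1) - F (fun n => (z (b + n)).2)| ^ 2
        ≤ ((c - a) * ({z : ℕ → Ω × Ω | ∃ m, b ≤ m ∧ z m ∉ Set.diagonal Ω}).indicator 1 z) ^ 2 :=
          pow_le_pow_left₀ (abs_nonneg _) h1 2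
      _ ≤ (c - a) ^ 2 * ({z : ℕ → Ω × Ω | ∃ m, b ≤ m ∧ z m ∉ Set.diagonal Ω}).indicator 1 z := by
          have hI1 : ({z : ℕ → Ω × Ω | ∃ m, b ≤ m ∧ z m ∉ Set.diagonal Ω}).indicator (1 : (ℕ → Ω × Ω) → ℝ) z ≤ 1 :=
            Set.indicator_le_self' (fun _ _ => zero_le_one) _
          rw [mul_pow]
          exact mul_le_mul_of_nonneg_left (by nlinarith) (sq_nonneg _)
  have h := crn_chain_notMerged_after_le hw hw0 hmax Khat hK μ₀ b
  rw [← hP] at h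
  calc ∫ z, (F (fun n => (z (b + n)).1) - F (fun n => (z (b + n)).2)) ^ 2 ∂P
      ≤ ∫ z, (c - a) ^ 2 * ({z : ℕ → Ω × Ω | ∃ m, b ≤ m ∧ z m ∉ Set.diagonal Ω}).indicator 1 z ∂P :=
        integral_mono hSi hIi hpt
    _ = (c - a) ^ 2 * P.real {z : ℕ → Ω × Ω | ∃ m, b ≤ m ∧ z m ∉ Set.diagonal Ω} := by
        rw [integral_const_mul, integral_indicator_one hE]
    _ ≤ (c - a) ^ 2 * ((1 - (w x₀)⁻¹) ^ b * μ₀.real (Set.diagonal Ω)ᶜ) := mul_le_mul_of_nonneg_left h (sq_nonneg _)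
    _ = _ := by ring

/-- **`|E F(X_{b+·}) − E F(X′_{b+·})| ≤ r^b·P(X_0 ≠ X′_0)·(c − a)`** in the same setting. [ours] -/
theorem crn_chain_path_integral_sub_abs_le_init [MeasurableEq Ω] (hw : Measurable w) (hw0 : ∀ y, 0 < w y) {x₀ : Ω}
    (hmax : ∀ y, w y ≤ w x₀) [IsProbabilityMeasure (q.withDensity fun y => ENNReal.ofReal (w y))]
    (Khat : Kernel (Ω × Ω) (Ω × Ω)) [IsMarkovKernel Khat]
    (hK : ∀ z : Ω × Ω, Khat z = (q.prod (volume : Measure unitInterval)).map (fun p : Ω × unitInterval =>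
      ((if (p.2 : ℝ) * w z.1 ≤ w p.1 then p.1 else z.1), (if (p.2 : ℝ) * w z.2 ≤ w p.1 then p.1 else z.2))))
    (μ₀ : Measure (Ω × Ω)) [IsProbabilityMeasure μ₀] (b : ℕ) {F : (ℕ → Ω) → ℝ} (hF : Measurable F) {a c : ℝ}
    (ha : ∀ x, a ≤ F x) (hc : ∀ x, F x ≤ c) :
    |∫ z, F (fun n => (z (b + n)).1) ∂(Kernel.trajMeasure (X := fun _ : ℕ => Ω × Ω) μ₀
          (fun n : ℕ => Khat.comap (fun h : (i : ↥(Finset.Iic n)) → Ω × Ω => h ⟨n, Finset.mem_Iic.2 le_rfl⟩)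
            (measurable_pi_apply _))) -
      ∫ z, F (fun n => (z (b + n)).2) ∂(Kernel.trajMeasure (X := fun _ : ℕ => Ω × Ω) μ₀
          (fun n : ℕ => Khat.comap (fun h : (i : ↥(Finset.Iic n)) → Ω × Ω => h ⟨n, Finset.mem_Iic.2 le_rfl⟩)
            (measurable_pi_apply _)))| ≤ (1 - (w x₀)⁻¹) ^ b * μ₀.real (Set.diagonal Ω)ᶜ * (c - a) := by
  set P := Kernel.trajMeasure (X := fun _ : ℕ => Ω × Ω) μ₀
      (fun n : ℕ => Khat.comap (fun h : (i : ↥(Finset.Iic n)) → Ω × Ω => h ⟨n, Finset.mem_Iic.2 le_rfl⟩)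
        (measurable_pi_apply _)) with hP
  have hC : ∀ x, |F x| ≤ max |a| |c| := fun x => abs_le_max_abs_abs (ha x) (hc x)
  have h1i : Integrable (fun z : ℕ → Ω × Ω => F (fun n => (z (b + n)).1)) P :=
    integrable_of_bounded P (hF.comp (measurable_pi_lambda _ fun n => measurable_fst.comp (measurable_pi_apply (b + n))))
      (fun z => hC _)
  have h2i : Integrable (fun z : ℕ → Ω × Ω => F (fun n => (z (b + n)).2)) P :=
    integrable_of_bounded P (hF.comp (measurable_pi_lambda _ fun n => measurable_snd.comp (measurable_pi_apply (b + n))))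
      (fun z => hC _)
  rw [← integral_sub h1i h2i]
  refine (abs_integral_le_integral_abs).trans ?_
  rw [hP]
  exact crn_chain_path_integral_abs_sub_le_init hw hw0 hmax Khat hK μ₀ b hF ha hc

/-! ## §2 The coupling inequality for the exact sampler -/

/-- **THE COUPLING INEQUALITY FOR FLOW-MCMC**: `w` measurable (a `Fact`), positive, normalised, maximal at `x₀`
(`r = 1 − 1/w(x₀)`); `MeasurableEq Ω`.  For EVERY probability law `μ̂₀` on `Ω × Ω`, every `b` and every measurable path statistic
`a ≤ F ≤ c`, the runs of `K = indepMH q w` from the two marginals of `μ̂₀` satisfy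
`|E_{μ̂₀∘fst⁻¹} F(X_{b+·}) − E_{μ̂₀∘snd⁻¹} F(X_{b+·})| ≤ r^b·μ̂₀(Δᶜ)·(c − a)`. [ours] -/
theorem imh_chain_shift_integral_sub_le_of_coupling [MeasurableEq Ω] [Fact (Measurable w)] (hw0 : ∀ y, 0 < w y) {x₀ : Ω}
    (hmax : ∀ y, w y ≤ w x₀) [IsProbabilityMeasure (q.withDensity fun y => ENNReal.ofReal (w y))]
    (μ₀ : Measure (Ω × Ω)) [IsProbabilityMeasure μ₀] (b : ℕ) {F : (ℕ → Ω) → ℝ} (hF : Measurable F) {a c : ℝ}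
    (ha : ∀ x, a ≤ F x) (hc : ∀ x, F x ≤ c) :
    |∫ x, F (fun n => x (b + n)) ∂(Kernel.trajMeasure (X := fun _ : ℕ => Ω) (μ₀.map Prod.fst)
          (fun n : ℕ => (indepMH q w).comap (fun h : (i : ↥(Finset.Iic n)) → Ω => h ⟨n, Finset.mem_Iic.2 le_rfl⟩)
            (measurable_pi_apply _))) -
      ∫ x, F (fun n => x (b + n)) ∂(Kernel.trajMeasure (X := fun _ : ℕ => Ω) (μ₀.map Prod.snd)
          (fun n : ℕ => (indepMH q w).comap (fun h : (i : ↥(Finset.Iic n)) → Ω => h ⟨n, Finset.mem_Iic.2 le_rfl⟩)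
            (measurable_pi_apply _)))| ≤ (1 - (w x₀)⁻¹) ^ b * μ₀.real (Set.diagonal Ω)ᶜ * (c - a) := by
  have hw : Measurable w := Fact.out
  obtain ⟨Khat, hMarkov, hK⟩ := exists_crnPairKernel (q := q) hw
  haveI := hMarkov
  have hFs : Measurable (fun x : ℕ → Ω => F (fun n => x (b + n))) :=
    hF.comp (measurable_pi_lambda _ fun n => measurable_pi_apply (b + n))
  have hπ1 : Measurable (fun (z : ℕ → Ω × Ω) (n : ℕ) => (z n).1) :=
    measurable_pi_lambda _ fun n => measurable_fst.comp (measurable_pi_apply n)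
  have hπ2 : Measurable (fun (z : ℕ → Ω × Ω) (n : ℕ) => (z n).2) :=
    measurable_pi_lambda _ fun n => measurable_snd.comp (measurable_pi_apply n)
  rw [← crn_chain_map_fst hw0 Khat hK μ₀, ← crn_chain_map_snd hw0 Khat hK μ₀,
    integral_map hπ1.aemeasurable hFs.aestronglyMeasurable, integral_map hπ2.aemeasurable hFs.aestronglyMeasurable]
  exact crn_chain_path_integral_sub_abs_le_init hw hw0 hmax Khat hK μ₀ b hF ha hc

end Summit.Ventures.LatticeQCDFlow.Exactness

end
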